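import Mathlib.Topology.Instances.Matrix
import Summits.QuantumFields.YangMills.Theorems.EquipartitionCriticalityEquipartitionPinsProbeTangentDefs
import Summits.QuantumFields.YangMills.Theorems.EquipartitionCriticalityEquipartitionPinsProbeTangentComb
import HarnessLib

/-!
# The rescaled plaquette field is a continuous cylinder observable

Crux `stmt-QuantumFields-8760`
(`Summit.QuantumFields.YangMills.Theses.EquipartitionCriticality.EquipartitionPinsProbe`), line
`Sketch`, stub `stub_plaqFieldContinuous` (TC3).

For a continuous unitary lattice representation `r` of a topological group `G` and `β : ℝ`, the
rescaled plaquette field `plaqField r β : LGConfig 4 G → (ZdPlaquette 4 → Fin D → ℝ)` of the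
definitions file `…TangentDefs` is

* **continuous** for the product topologies: each coordinate `U ↦ Y_p^a(U)` is a signed sum of four
  link fields `√β · Re tr((ρ(Ũ_e) − 1) e_a†)`, where the gauge-fixed link `Ũ_e = G_U(x) U_e G_U(x+e_l)⁻¹`
  is a finite product of link variables and their inverses (the comb transport `G_U` is a product of
  four straight transports), hence continuous in `U`; `ρ`, matrix multiplication, the trace and
  `re` are continuous;
* **a cylinder observable** in each coordinate: `Y_p^a(U)` reads only the links in the finite box
  `{(z, k) : |z_j| ≤ R}` with `R = 2 + ∑_j |x_j|` (`x` the base point of `p`), because the comb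
  transport `G_U(b)` reads only comb edges `(z, k)` with `|z_j| ≤ |b_j|`
  (`CombBasics.combTransport_congr`) and the base points `b` entering the four gauge-fixed boundary
  links of `p` satisfy `|b_j| ≤ |x_j| + 1`.

Reference: S. Chatterjee, arXiv:1602.01222, §9 (axial gauge). Mathlib + the line's landed files only.
-/

noncomputable section

open scoped Matrix
open Literature.Probability.LatticeModels Literature.MathematicalPhysics.QuantumLattice
open Literature.MathematicalPhysics.QuantumFieldTheory

namespace Summit.QuantumFields.YangMills.Theorems.EquipartitionPinsProbe

namespace TangentPlaqFieldContinuous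

/-! ### Continuity -/

section Continuity

variable {d : ℕ} {G : Type} [Group G] [TopologicalSpace G] [IsTopologicalGroup G]

/-- The straight forward transport `U ↦ U(y,k) U(y+e_k,k) ⋯ U(y+(n-1)e_k,k)` is continuous in `U`. -/
theorem continuous_line (k : Fin d) :
    ∀ (n : ℕ) (y : Site d), Continuous fun U : LGConfig d G => ZdGaugeConfig.line U k n y
  | 0, _ => continuous_const
  | n + 1, y => by
    show Continuous fun U : LGConfig d G => U (y, k) * ZdGaugeConfig.line U k n (y + Pi.single k 1)
    exact (continuous_apply _).mul (continuous_line k n _)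

/-- The signed straight transport `U ↦ lineZ U k m y` is continuous in `U`. -/
theorem continuous_lineZ (k : Fin d) (m : ℤ) (y : Site d) :
    Continuous fun U : LGConfig d G => lineZ U k m y := by
  rcases m with n | n
  · exact continuous_line k n y
  · exact (continuous_line k (n + 1) _).inv

/-- The comb transport `U ↦ G_U(x)` is continuous in `U`. -/
theorem continuous_combTransport (x : Site 4) :
    Continuous fun U : LGConfig 4 G => combTransport U x := by
  simp only [CombBasics.combTransport_def]
  exact (((continuous_lineZ 0 _ _).mul (continuous_lineZ 1 _ _)).mul (continuous_lineZ 2 _ _)).mul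
    (continuous_lineZ 3 _ _)

/-- The gauge-fixed link variable `U ↦ Ũ_e = G_U(x) U_e G_U(x + e_l)⁻¹` is continuous in `U`. -/
theorem continuous_axialFix (e : Literature.MathematicalPhysics.QuantumLattice.ZdEdge 4) :
    Continuous fun U : LGConfig 4 G => axialFix U e := by
  simp only [CombBasics.axialFix_apply]
  exact ((continuous_combTransport e.1).mul (continuous_apply e)).mul (continuous_combTransport _).inv

variable (r : LatticeRep G)

omit [IsTopologicalGroup G] in
/-- The Frobenius coordinate `M ↦ Re tr(M e_a†)` is continuous. -/
theorem continuous_lieCoord (a : Fin (lieDim r)) :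
    Continuous fun M : Matrix (Fin r.N) (Fin r.N) ℂ => lieCoord r M a := by
  unfold lieCoord
  exact Complex.continuous_re.comp ((continuous_id.matrix_mul continuous_const).matrix_trace)

/-- The rescaled gauge-fixed link field `U ↦ A_e^a(U)` is continuous in `U`. -/
theorem continuous_linkField (β : ℝ) (e : Literature.MathematicalPhysics.QuantumLattice.ZdEdge 4)
    (a : Fin (lieDim r)) : Continuous fun U : LGConfig 4 G => linkField r β U e a := by
  unfold linkField
  exact continuous_const.mul ((continuous_lieCoord r a).comp
    ((r.continuous.comp (continuous_axialFix e)).sub continuous_const))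

/-- Each coordinate `U ↦ Y_p^a(U)` of the rescaled plaquette field is continuous in `U`. -/
theorem continuous_plaqField_apply (β : ℝ) (p : ZdPlaquette 4) (a : Fin (lieDim r)) :
    Continuous fun U : LGConfig 4 G => plaqField r β U p a := by
  simp only [plaqField, plaquetteCurl]
  exact continuous_finsetSum _ fun i _ => continuous_const.mul (continuous_linkField r β _ a)

/-- The rescaled plaquette field `U ↦ Y(U)` is continuous into the product space. -/
theorem continuous_plaqField (β : ℝ) : Continuous (plaqField (G := G) r β) :=
  continuous_pi fun p => continuous_pi fun a => continuous_plaqField_apply r β p a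

end Continuity

/-! ### Cylinder support -/

section Cylinder

variable {G : Type} [Group G]

/-- A unit step changes every coordinate by at most one in absolute value. -/
theorem abs_add_single_le (x : Site 4) (i j : Fin 4) : |(x + Pi.single i 1 : Site 4) j| ≤ |x j| + 1 := by
  rw [Pi.add_apply]
  refine (abs_add_le _ _).trans ?_
  gcongr
  rw [Pi.single_apply]
  split_ifs <;> simp

/-- If `U` and `U'` agree on all edges `(z, k)` with `‖z‖∞ ≤ R` and `‖b‖∞ ≤ R`, their comb transports
to `b` agree. -/
theorem combTransport_congr_of_box {U U' : LGConfig 4 G} {R : ℤ}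
    (hUU' : ∀ (z : Site 4) (k : Fin 4), (∀ j, |z j| ≤ R) → U (z, k) = U' (z, k))
    (b : Site 4) (hb : ∀ j, |b j| ≤ R) : combTransport U b = combTransport U' b :=
  CombBasics.combTransport_congr b fun z k _ hz => hUU' z k fun j => (hz j).trans (hb j)

/-- If `U` and `U'` agree on all edges `(z, k)` with `‖z‖∞ ≤ R` and `‖x‖∞ + 1 ≤ R`, their gauge-fixed
links at the edge `(x, l)` agree. -/
theorem axialFix_congr_of_box {U U' : LGConfig 4 G} {R : ℤ}
    (hUU' : ∀ (z : Site 4) (k : Fin 4), (∀ j, |z j| ≤ R) → U (z, k) = U' (z, k))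
    (x : Site 4) (l : Fin 4) (hx : ∀ j, |x j| + 1 ≤ R) : axialFix U (x, l) = axialFix U' (x, l) := by
  have h0 : ∀ j, |x j| ≤ R := fun j => by linarith [hx j, abs_nonneg (x j)]
  rw [CombBasics.axialFix_apply, CombBasics.axialFix_apply, combTransport_congr_of_box hUU' x h0,
    combTransport_congr_of_box hUU' (x + Pi.single l 1) fun j => (abs_add_single_le x l j).trans (hx j),
    hUU' x l h0]

variable [TopologicalSpace G] (r : LatticeRep G)

/-- If `U` and `U'` agree on all edges `(z, k)` with `‖z‖∞ ≤ R` and `‖x‖∞ + 1 ≤ R`, their rescaled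
link fields at the edge `(x, l)` agree. -/
theorem linkField_congr_of_box (β : ℝ) {U U' : LGConfig 4 G} {R : ℤ}
    (hUU' : ∀ (z : Site 4) (k : Fin 4), (∀ j, |z j| ≤ R) → U (z, k) = U' (z, k))
    (x : Site 4) (l : Fin 4) (hx : ∀ j, |x j| + 1 ≤ R) (a : Fin (lieDim r)) :
    linkField r β U (x, l) a = linkField r β U' (x, l) a := by
  unfold linkField
  rw [axialFix_congr_of_box hUU' x l hx]

/-- **The plaquette field coordinate `Y_p^a` is a cylinder observable** supported in the finite box
of edges `(z, k)` with `|z_j| ≤ R` for all `j`, as soon as `‖x‖∞ + 2 ≤ R`, `x` the base point of `p`. -/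
theorem isCylinder_plaqField (β : ℝ) (p : ZdPlaquette 4) (a : Fin (lieDim r)) (R : ℤ)
    (hR : ∀ j, |p.1 j| + 2 ≤ R) :
    IsCylinder (fun U : LGConfig 4 G => plaqField r β U p a)
      ((Fintype.piFinset fun _ : Fin 4 => Finset.Icc (-R) R) ×ˢ Finset.univ) := by
  intro U U' hUU'
  have hUU : ∀ (z : Site 4) (k : Fin 4), (∀ j, |z j| ≤ R) → U (z, k) = U' (z, k) := fun z k hz =>
    hUU' (z, k) (Finset.mem_product.2
      ⟨Fintype.mem_piFinset.2 fun j => Finset.mem_Icc.2 (abs_le.1 (hz j)), Finset.mem_univ _⟩)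
  have h0 : ∀ j : Fin 4, |p.1 j| + 1 ≤ R := fun j => by linarith [hR j]
  have h1 : ∀ (i j : Fin 4), |(p.1 + Pi.single i 1 : Site 4) j| + 1 ≤ R := fun i j => by
    linarith [abs_add_single_le p.1 i j, hR j]
  simp only [plaqField, plaquetteCurl_eq]
  rw [linkField_congr_of_box r β hUU p.1 p.2.1.1 h0,
    linkField_congr_of_box r β hUU (p.1 + Pi.single p.2.1.1 1) p.2.1.2 (h1 _),
    linkField_congr_of_box r β hUU (p.1 + Pi.single p.2.1.2 1) p.2.1.1 (h1 _),
    linkField_congr_of_box r β hUU p.1 p.2.1.2 h0]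

/-- The radius `2 + ∑_j |x_j|` is admissible for the plaquettes based at `x`. -/
theorem abs_add_two_le_sum (x : Site 4) (j : Fin 4) : |x j| + 2 ≤ 2 + ∑ i, |x i| := by
  linarith [Finset.single_le_sum (fun i _ => abs_nonneg (x i)) (Finset.mem_univ j)]

end Cylinder

end TangentPlaqFieldContinuous

/-- STUB `stub_plaqFieldContinuous` (TC3) of line `Sketch` (crux `stmt-QuantumFields-8760`) — **the
rescaled plaquette field is a continuous cylinder observable**: `plaqField r β` is continuous from
`LGConfig 4 G` (product topology) into the product space `ZdPlaquette 4 → Fin D → ℝ`, and each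
coordinate `U ↦ Y_p^a(U)` depends only on the links in a finite box around `p`. -/
theorem stub_plaqFieldContinuous :
    ∀ (G : Type) [Group G] [TopologicalSpace G] [IsTopologicalGroup G]
      (r : Literature.MathematicalPhysics.QuantumFieldTheory.LatticeRep G) (β : ℝ),
      Continuous (Summit.QuantumFields.YangMills.Theorems.EquipartitionPinsProbe.plaqField r β) ∧
      ∀ (p : Literature.MathematicalPhysics.QuantumLattice.ZdPlaquette 4) (a : Fin (Summit.QuantumFields.YangMills.Theorems.EquipartitionPinsProbe.lieDim r)), ∃ S : Finset (Literature.MathematicalPhysics.QuantumLattice.ZdEdge 4),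
        Literature.MathematicalPhysics.QuantumLattice.IsCylinder (fun U : Literature.MathematicalPhysics.QuantumLattice.LGConfig 4 G => Summit.QuantumFields.YangMills.Theorems.EquipartitionPinsProbe.plaqField r β U p a) S := by
  intro G _ _ _ r β
  exact ⟨TangentPlaqFieldContinuous.continuous_plaqField r β,
    fun p a => ⟨_, TangentPlaqFieldContinuous.isCylinder_plaqField r β p a _
      (TangentPlaqFieldContinuous.abs_add_two_le_sum p.1)⟩⟩

end Summit.QuantumFields.YangMills.Theorems.EquipartitionPinsProbe

end
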